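import Literature.NumberTheory.Automorphic.BianchiOrdinaryClassicality
import Literature.NumberTheory.Automorphic.TorusEigensystemGrossencharakter
import Literature.NumberTheory.GaloisRepresentations.GrossencharakterAlgebra
import Literature.NumberTheory.Automorphic.BianchiBorelReduction
import Literature.NumberTheory.Automorphic.BorelModelFinite
import Literature.NumberTheory.Automorphic.ReducibleGaloisRepOfCharacters
import Literature.NumberTheory.Automorphic.UnramifiedLevelChange
import Literature.FieldTheory.AlgClosed.PadicAlgClEquivComplex
import HarnessLib

/-!
# Boundary Hecke eigensystems of Bianchi groups are reducible — the proof

Topic `NumberTheory/Automorphic`; namespace `Literature.NumberTheory.Automorphic`.  Theorems only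
(proof file under the named fact `bianchi_boundaryEigensystem_isReducible` of
`BianchiOrdinaryClassicality`).

`bianchi_boundaryEigensystem_isReducible_holds` discharges the named fact:
a non-interior Hecke eigenclass of `H^q(X_U, Ṽ_wt(ℚ̄_p))` for `GL₂` over an imaginary quadratic
field has the Hecke eigenvalues of `χ₁ ⊕ χ₂` for two `p`-adic characters, almost everywhere.
The assembly of Harder's argument [Harder1987, §1–§2] as vendored in this topic:

1. (A–B) the class gives a non-zero eigenclass `y` of the Borel stratum
   (`BianchiBorelReduction.exists_borelEigenclass_of_not_mem_interiorCohomology`);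
2. pull `y` back to a neat principal level `K_f(𝔫) ≤ U` (`NeatLevelImaginaryQuadratic`,
   `TwistedQuotientLevelPullback`, `UnramifiedLevelChange`: the eigenvalues at the unramified
   places are unchanged);
3. (C, factorisation) in the good-place model `H_S`, `S = {v ∣ 𝔫}`, the eigenvalues factor as
   `a_{w,1} = N(w) ζ_w μ_w⁻¹ + μ_w`, `a_{w,2} = ζ_w` through the eigenvalues `μ_w ≠ 0`, `ζ_w` of
   `t^B_{2,w}` and of the centre on a class `y₀ ≠ 0` (`BorelEigenvalueFactorisation`);
4. (C, algebraicity) `w ↦ μ_w` is an algebraic Größencharakter (`TorusEigensystemGrossencharakter`: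
   torus factorisation, orbit restriction, Shapiro, and the eigencharacters of `H^q(Λ, V_wt)`), and
   so is the central system `w ↦ a_{w,2}` of the original class (`CentralEigensystemComplex`);
   hence so are `μ` and `N ζ μ⁻¹` (`GrossencharakterAlgebra`);
5. (D) Weil's `p`-adic characters of these Größencharaktere (`ReducibleGaloisRepOfCharacters`,
   `exists_galoisCharacter_of_isGrossencharakter`) sum to the required reducible representation
   (`FramedGaloisRep.exists_sum_of_characters`, `heckeFrobPoly_two_eq`).

## References

* G. Harder, *Eisenstein cohomology of arithmetic groups. The case GL₂*, Invent. Math. 89 (1987),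
  §1–§2. [Harder1987]
* C. Khare, J. Thorne, *Potential automorphy and the Leopoldt conjecture*, Amer. J. Math. 139
  (2017), §6.5, proof of Thm. 6.23. [KhareThorne2017]
-/

noncomputable section

open scoped NumberField
open IsDedekindDomain NumberField Polynomial

namespace Literature.NumberTheory.Automorphic

open ParallelWeight BigHeckeGLn Literature.NumberTheory.GaloisRepresentations

/-! ### Preliminaries -/

section Prelim

variable {F : Type} [Field F] [NumberField F]

/-- All but finitely many `v` do not contain the rational prime `ℓ ≠ 0`. [folklore] -/
theorem eventually_natCast_not_mem_asIdeal' {ℓ : ℕ} (hℓ : ℓ ≠ 0) :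
    ∀ᶠ v : HeightOneSpectrum (𝓞 F) in Filter.cofinite, (ℓ : 𝓞 F) ∉ v.asIdeal := by
  have hne : Ideal.span {(ℓ : 𝓞 F)} ≠ ⊥ := by
    rw [Ne, Ideal.span_singleton_eq_bot]
    exact_mod_cast hℓ
  refine Filter.mem_of_superset (Ideal.finite_factors hne).compl_mem_cofinite ?_
  intro v hv hmem
  exact hv (Ideal.dvd_span_singleton.2 hmem)

/-- All but finitely many `v` satisfy `¬ 𝔣 ≤ v` (`𝔣 ≠ 0`). [folklore] -/
theorem eventually_not_le_asIdeal {𝔣 : Ideal (𝓞 F)} (h𝔣 : 𝔣 ≠ ⊥) :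
    ∀ᶠ v : HeightOneSpectrum (𝓞 F) in Filter.cofinite, ¬ 𝔣 ≤ v.asIdeal := by
  refine Filter.mem_of_superset (Ideal.finite_factors h𝔣).compl_mem_cofinite ?_
  intro v hv hle
  exact hv (Ideal.dvd_iff_le.2 hle)

/-- A Größencharakter modulo `𝔣` is one modulo every `𝔣' ≤ 𝔣`. [folklore] -/
theorem _root_.Literature.NumberTheory.GaloisRepresentations.IsGrossencharakter.of_le {𝔣 𝔣' : Ideal (𝓞 F)}
    {p q : InfinitePlace F → ℤ} {ψ : HeightOneSpectrum (𝓞 F) → ℂ} (h : IsGrossencharakter 𝔣 p q ψ)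
    (hle : 𝔣' ≤ 𝔣) : IsGrossencharakter 𝔣' p q ψ :=
  ⟨fun v hv => h.ne_zero v fun hle' => hv (hle.trans hle'),
    fun b c hb hc hcop hbc hpos =>
      h.idealPow_span_eq b c hb hc (hcop.of_isCoprime_of_dvd_right (Ideal.dvd_iff_le.2 hle)) (hle hbc) hpos⟩

/-- `K_f(𝔫)` is compact (`𝔫 ≠ 0`). [folklore] -/
theorem isCompact_comap_principalCongruenceLevel {𝔫 : Ideal (𝓞 F)} (h𝔫 : 𝔫 ≠ 0) :
    IsCompact (((principalCongruenceLevel 2 F 𝔫).comap (GLn.ofFinite 2 F) : Subgroup (FiniteAdelicGL 2 F)) :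
      Set (FiniteAdelicGL 2 F)) :=
  (isCompact_glFiniteIntegralLevel_holds 2 F).of_isClosed_subset
    (Subgroup.isClosed_of_isOpen _ (isOpen_comap_ofFinite_principalCongruenceLevel 2 F h𝔫))
    (comap_ofFinite_principalCongruenceLevel_le 2 F 𝔫)

end Prelim

/-! ### The theorem -/

set_option maxHeartbeats 800000 in
/-- **Boundary Hecke eigensystems of Bianchi groups are reducible**: the discharge of the named
fact `bianchi_boundaryEigensystem_isReducible`.  See the module docstring for the assembly.
[cite: Harder1987, §1–§2] [cite: KhareThorne2017, §6.5, proof of Thm. 6.23] -/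
theorem bianchi_boundaryEigensystem_isReducible_holds : bianchi_boundaryEigensystem_isReducible := by
  intro F _ _ hTC hF2 p _ wt _hwt U hUo hUc q ξ hξ a ha
  classical
  haveI : IsTotallyComplex F := hTC
  obtain ⟨ιE⟩ := PadicAlgCl.nonempty_ringEquiv_complex p
  -- (1) a non-zero eigenclass of the Borel stratum
  obtain ⟨y, hy0, hy⟩ := exists_borelEigenclass_of_not_mem_interiorCohomology (PadicAlgCl p) F wt U q hξ a ha
  -- (2) a neat principal level `K_f(𝔫) ≤ U`
  obtain ⟨𝔫₀, h𝔫₀, hU0⟩ := exists_principalCongruenceLevel_sndHom_mem (n := 2) (K := F) hUo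
  obtain ⟨𝔫, h𝔫, hle𝔫, hneat⟩ := exists_neat_level hF2 h𝔫₀
  have hle : (principalCongruenceLevel 2 F 𝔫).comap (GLn.ofFinite 2 F) ≤ U :=
    (comap_principalCongruenceLevel_mono h𝔫 hle𝔫).trans (comap_principalCongruenceLevel_le_of_sndHom_mem hU0)
  haveI hfi : (((principalCongruenceLevel 2 F 𝔫).comap (GLn.ofFinite 2 F)).subgroupOf U).FiniteIndex :=
    Subgroup.finiteIndex_subgroupOf_of_isCompact_isOpen hUc (isOpen_comap_ofFinite_principalCongruenceLevel 2 F h𝔫)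
  -- pull `y` back to level `K_f(𝔫)`
  have hinj := TwistedQuotient.pullbackMap_injective ((globalEmbedding 2 F).comp (borel F).subtype)
    (borelCoeffRep (PadicAlgCl p) wt) hle q fun x hx => by
      have hidx : ((((principalCongruenceLevel 2 F 𝔫).comap (GLn.ofFinite 2 F)).subgroupOf U).index :
          PadicAlgCl p) ≠ 0 := Nat.cast_ne_zero.2 Subgroup.FiniteIndex.index_ne_zero
      rw [← Nat.cast_smul_eq_nsmul (PadicAlgCl p), smul_eq_zero] at hx
      exact hx.resolve_left hidx
  set y' := (TwistedQuotient.pullbackMap ((globalEmbedding 2 F).comp (borel F).subtype)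
    (borelCoeffRep (PadicAlgCl p) wt) hle q).hom y with hy'def
  have hy'0 : y' ≠ 0 := fun h0 => hy0 (hinj (h0.trans (map_zero _).symm))
  have hy' : ∀ᶠ w in Filter.cofinite,
      TwistedQuotient.heckeEnd ((globalEmbedding 2 F).comp (borel F).subtype)
          ((principalCongruenceLevel 2 F 𝔫).comap (GLn.ofFinite 2 F)) (borelCoeffRep (PadicAlgCl p) wt)
          (heckeElement 2 F w 1) q y' = a w 1 • y' ∧
        TwistedQuotient.heckeEnd ((globalEmbedding 2 F).comp (borel F).subtype)
          ((principalCongruenceLevel 2 F 𝔫).comap (GLn.ofFinite 2 F)) (borelCoeffRep (PadicAlgCl p) wt)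
          (heckeElement 2 F w 2) q y' = a w 2 • y' := by
    obtain ⟨S₀, hS₀, hS₀unr, -⟩ := exists_goodPlaces hUo hUc
    filter_upwards [hy, hS₀.compl_mem_cofinite, (Ideal.finite_factors h𝔫).compl_mem_cofinite] with w hw hwS₀ hw𝔫
    have hunrU := hS₀unr w hwS₀
    have hunrL := isUnramifiedLevel_comap_principalCongruenceLevel (n := 2) h𝔫 hw𝔫
    have key : ∀ (j : ℕ) (c : PadicAlgCl p), borelHeckeT (PadicAlgCl p) F wt U q w j y = c • y →
        TwistedQuotient.heckeEnd ((globalEmbedding 2 F).comp (borel F).subtype)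
          ((principalCongruenceLevel 2 F 𝔫).comap (GLn.ofFinite 2 F)) (borelCoeffRep (PadicAlgCl p) wt)
          (heckeElement 2 F w j) q y' = c • y' := by
      intro j c hj
      rw [hy'def, heckeElement_eq_ofLocal,
        ← TwistedQuotient.pullbackMap_heckeEnd_of_isUnramifiedLevel _ _ hle hunrU hunrL _
          (finite_doubleCosetQuot_of_isCompact_isOpen U hUc hUo _) q y,
        ← heckeElement_eq_ofLocal]
      change (TwistedQuotient.pullbackMap _ _ hle q).hom (borelHeckeT (PadicAlgCl p) F wt U q w j y) = _
      rw [hj, map_smul]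
    exact ⟨key 1 _ hw.1, key 2 _ hw.2⟩
  -- (3) the good-place model `H_S`, `S = {v ∣ 𝔫}`, and the factorisation of the eigenvalues
  have hSfin : ({v : HeightOneSpectrum (𝓞 F) | v.asIdeal ∣ 𝔫} : Set _).Finite := Ideal.finite_factors h𝔫
  have hS𝔫 : ∀ v : HeightOneSpectrum (𝓞 F), v.asIdeal ∣ 𝔫 → v ∈ ({v : HeightOneSpectrum (𝓞 F) | v.asIdeal ∣ 𝔫} : Set _) :=
    fun v hv => hv
  have hUnr : ∀ w, w ∉ ({v : HeightOneSpectrum (𝓞 F) | v.asIdeal ∣ 𝔫} : Set _) →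
      ArithmeticQuotient.IsUnramifiedLevel (valuedCongruenceSubgroup (Fin 2) (1 : WithZero (Multiplicative ℤ)))
        (ofLocal 2 F w) (localComponent 2 F w) ((principalCongruenceLevel 2 F 𝔫).comap (GLn.ofFinite 2 F)) :=
    fun w hw => isUnramifiedLevel_comap_principalCongruenceLevel h𝔫 hw
  have hHU : ∀ g : FiniteAdelicGL 2 F, ∃ h : borelAwayFrom (n := 2) ({v : HeightOneSpectrum (𝓞 F) | v.asIdeal ∣ 𝔫} : Set _),
      ∃ u ∈ (principalCongruenceLevel 2 F 𝔫).comap (GLn.ofFinite 2 F), g = (h : FiniteAdelicGL 2 F) * u :=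
    forall_exists_borelAwayFrom_mul _ fun k hk hkS =>
      mem_comap_principalCongruenceLevel_of_localComponent h𝔫 hk fun v hv => hkS v hv
  haveI : FiniteDimensional (PadicAlgCl p) (GLnCohomology.CoeffModule (PadicAlgCl p) 2 wt) :=
    inferInstanceAs (FiniteDimensional (PadicAlgCl p)
      ↥(Literature.NumberTheory.DiophantineGeometry.weylModule (PadicAlgCl p) (Fin 2) (GLnCohomology.coeffPartition wt)))
  haveI : Module.Finite (PadicAlgCl p) (CoeffModule (PadicAlgCl p) F 2 wt) :=
    inferInstanceAs (Module.Finite (PadicAlgCl p)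
      (PiTensorProduct (PadicAlgCl p) fun _τ : (F →+* PadicAlgCl p) => GLnCohomology.CoeffModule (PadicAlgCl p) 2 wt))
  haveI : FiniteDimensional (PadicAlgCl p) (borelModelCohomology ({v : HeightOneSpectrum (𝓞 F) | v.asIdeal ∣ 𝔫} : Set _)
      ((principalCongruenceLevel 2 F 𝔫).comap (GLn.ofFinite 2 F)) ((globalEmbedding 2 F).comp (borel F).subtype)
      (borel_globalEmbedding_mem_borelAwayFrom F _) (borelCoeffRep (PadicAlgCl p) wt) q) :=
    moduleFinite_cohomology_borel_subgroupModel hF2 _ (isOpen_comap_ofFinite_principalCongruenceLevel 2 F h𝔫)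
      (isCompact_comap_principalCongruenceLevel h𝔫) _ (borel_globalEmbedding_mem_borelAwayFrom F _) hHU _ q
  obtain ⟨y₀, μ, ζ, hy₀0, hfac, hev⟩ := exists_eigenvalue_factorisation ((globalEmbedding 2 F).comp (borel F).subtype)
    (borel_globalEmbedding_mem_borelAwayFrom F _) (borelCoeffRep (PadicAlgCl p) wt) q hSfin hUnr hHU hy'0 a hy'
  -- (4) the Größencharaktere `μ` and `ζ = a(·, 2)`
  obtain ⟨e, hμ⟩ := isGrossencharakter_torusEigensystem (PadicAlgCl p) wt ιE hF2 h𝔫 hneat hSfin hS𝔫 q hy₀0 μ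
    (fun w hw => (hfac w hw).1) (fun w hw => (hfac w hw).2.2)
  have hS₂fin : ({w : HeightOneSpectrum (𝓞 F) | ¬ ParallelWeight.heckeT (PadicAlgCl p) F 2 wt U q w 2 ξ = a w 2 • ξ} : Set _).Finite :=
    Filter.eventually_cofinite.1 (ha.mono fun w hw => hw.2)
  have hξ0 : ξ ≠ 0 := by
    rintro rfl
    exact hξ (Submodule.zero_mem _)
  have hζ := isGrossencharakter_centralEigensystem (n := 2) (wt := wt) (U := U) (q := q) ιE h𝔫 hle hS₂fin hξ0
    (fun w => a w 2) fun w hw => by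
      by_contra h
      exact hw h
  have h𝔣₁ := conductorOf_ne_bot h𝔫 hSfin
  have h𝔣₂ := conductorOf_ne_bot h𝔫 hS₂fin
  have h𝔣 : conductorOf 𝔫 hSfin * conductorOf 𝔫 hS₂fin ≠ ⊥ := by
    rw [Ne, ← Ideal.zero_eq_bot, mul_eq_zero, not_or, Ideal.zero_eq_bot]
    exact ⟨h𝔣₁, h𝔣₂⟩
  have hμ' := hμ.of_le (Ideal.mul_le_right (I := conductorOf 𝔫 hSfin) (J := conductorOf 𝔫 hS₂fin))
  have hζ' := hζ.of_le (Ideal.mul_le_left (I := conductorOf 𝔫 hSfin) (J := conductorOf 𝔫 hS₂fin))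
  have hN := isGrossencharakter_absNorm (K := F) (conductorOf 𝔫 hSfin * conductorOf 𝔫 hS₂fin)
  -- (5) the Galois characters and their sum
  obtain ⟨r₁, hr₁⟩ := exists_galoisCharacter_of_isGrossencharakter h𝔣 hμ'.inv ιE
  obtain ⟨r₂, hr₂⟩ := exists_galoisCharacter_of_isGrossencharakter h𝔣 ((hN.mul hζ').mul hμ'.inv).inv ιE
  obtain ⟨σ, hss, hnirr, hσ⟩ := FramedGaloisRep.exists_sum_of_characters r₁ r₂
  refine ⟨σ, hss, hnirr, ?_⟩
  filter_upwards [hev, eventually_natCast_not_mem_asIdeal' (F := F) (Fact.out : p.Prime).ne_zero,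
    eventually_not_le_asIdeal h𝔣, hSfin.compl_mem_cofinite] with w hw hwp hw𝔣 hwS
  obtain ⟨h1u, h1c⟩ := hr₁ w hwp hw𝔣
  obtain ⟨h2u, h2c⟩ := hr₂ w hwp hw𝔣
  obtain ⟨hσu, hσc⟩ := hσ w h1u h2u
  refine ⟨hσu, ?_⟩
  have hμ0 : μ w ≠ 0 := (hfac w hwS).2.2
  have hα : ιE.symm ((ιE (μ w))⁻¹)⁻¹ = μ w := by
    rw [inv_inv, RingEquiv.symm_apply_apply]
  have hβ : ιE.symm ((((Ideal.absNorm w.asIdeal : ℕ) : ℂ) * ιE (a w 2) * (ιE (μ w))⁻¹)⁻¹)⁻¹ =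
      (Ideal.absNorm w.asIdeal : PadicAlgCl p) * a w 2 * (μ w)⁻¹ := by
    rw [inv_inv, map_mul, map_mul, map_inv₀, map_natCast, RingEquiv.symm_apply_apply, RingEquiv.symm_apply_apply]
  rw [hα] at h1c
  rw [hβ] at h2c
  have hpoly := heckeFrobPoly_two_eq (Ideal.absNorm w.asIdeal) (a w) (μ w)
    ((Ideal.absNorm w.asIdeal : PadicAlgCl p) * a w 2 * (μ w)⁻¹) (by rw [hw.1, hw.2]; ring)
    (by rw [hw.2]; field_simp)
  rw [hpoly]
  exact hσc _ _ h1c h2c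

end Literature.NumberTheory.Automorphic
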